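import Mathlib.GroupTheory.PresentedGroup
import Mathlib.Algebra.Group.Subgroup.Basic
import Mathlib.Algebra.Group.End
import Mathlib.Tactic.Group
import Literature.Topology.FourManifolds.GroupTrisections
import HarnessLib

/-!
# Stub `stub_transvectionPowCongruent` of line `power-twist-absorption` for crux `CongruenceShadows.ShadowsStandard`
(item stmt-SmoothPoincare4-14593, route route-SmoothPoincare4-CongruenceShadows)

**Power-twist absorption, non-separating piece** (any genus `g`).  Let
`S_g = ⟨a₁,b₁,…,a_g,b_g ∣ ∏[aᵢ,bᵢ]⟩` be the tree's surface group (`SurfaceGroup g`, generators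
`PresentedGroup.of (i,false) = aᵢ`, `PresentedGroup.of (i,true) = bᵢ`).  If an automorphism `T` of
`S_g` acts on the standard generators as the transvection `bᵢ ↦ bᵢ aᵢ` (every other generator, in
particular `aᵢ`, fixed), and `aᵢ ^ e` lies in a NORMAL subgroup `M`, then `T ^ e ≡ id (mod M)`,
i.e. `(T ^ e) s · s⁻¹ ∈ M` for every `s`:

1. `T ^ n` fixes every generator other than `bᵢ` and sends `bᵢ ↦ bᵢ aᵢ ^ n` (induction on `n`,
   `pow_succ` / `MulAut.mul_apply`);
2. hence `(T ^ e) x · x⁻¹ ∈ M` on generators: it is `1` for `x ≠ bᵢ` and the conjugate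
   `bᵢ aᵢ^e bᵢ⁻¹` of `aᵢ ^ e ∈ M` for `x = bᵢ` (`Subgroup.Normal.conj_mem`);
3. for normal `M` the set `{s | φ s · s⁻¹ ∈ M}` is a subgroup
   (`φ(st)(st)⁻¹ = (φ s · s⁻¹) · s (φ t · t⁻¹) s⁻¹`), and the generators `PresentedGroup.of x`
   generate `S_g` (`PresentedGroup.generated_by`).

This is the registered stub `stub_transvectionPowCongruent` (piece 2a) of the checked skeleton of the
line; pure proof over Mathlib (`PresentedGroup`, `MulAut`, `Subgroup.Normal`) and the tree's
`Literature.Topology.FourManifolds.{SurfaceGroup, surfaceGen}`; no definitions, no named facts.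
-/

-- the prescribed namespace `Summit.<P>.<Sub>.…` duplicates `SmoothPoincare4` (P = Sub)
set_option linter.dupNamespace false
noncomputable section
open Literature.Topology.FourManifolds Subgroup

namespace Summit.SmoothPoincare4.SmoothPoincare4.Theorems.ShadowsStandard.PowerTwistAbsorption

/-- **Generator criterion for congruence.**  For a NORMAL subgroup `M` of a presented group and an
endomorphism `φ`, if `φ x · x⁻¹ ∈ M` for every generator `x = PresentedGroup.of j`, then
`φ s · s⁻¹ ∈ M` for every `s`: the set of such `s` is a subgroup containing the generators.
[folklore] -/
private theorem congruent_of_generators {α : Type*} {rels : Set (FreeGroup α)}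
    (M : Subgroup (PresentedGroup rels)) [M.Normal]
    (φ : PresentedGroup rels →* PresentedGroup rels)
    (h : ∀ j : α, φ (PresentedGroup.of j) * (PresentedGroup.of j)⁻¹ ∈ M)
    (s : PresentedGroup rels) : φ s * s⁻¹ ∈ M := by
  let H : Subgroup (PresentedGroup rels) :=
    { carrier := {s | φ s * s⁻¹ ∈ M}
      mul_mem' := by
        intro s t hs ht
        have e : φ (s * t) * (s * t)⁻¹ = (φ s * s⁻¹) * (s * (φ t * t⁻¹) * s⁻¹) := by
          rw [map_mul]; group
        change φ (s * t) * (s * t)⁻¹ ∈ M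
        rw [e]
        exact M.mul_mem hs (Subgroup.Normal.conj_mem inferInstance _ ht s)
      one_mem' := by
        change φ 1 * (1 : PresentedGroup rels)⁻¹ ∈ M
        simp [M.one_mem]
      inv_mem' := by
        intro s hs
        change φ s⁻¹ * s⁻¹⁻¹ ∈ M
        have h1 : s * (φ s)⁻¹ ∈ M := by simpa using M.inv_mem hs
        have h2 : s⁻¹ * (s * (φ s)⁻¹) * s⁻¹⁻¹ ∈ M :=
          Subgroup.Normal.conj_mem inferInstance _ h1 s⁻¹
        simpa [map_inv, mul_assoc] using h2 }
  exact PresentedGroup.generated_by rels H h s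

/-- **STUB 2a · power of a non-separating transvection is congruent to the identity.**  If `T` acts
on the standard generators of `S_g` as `bᵢ ↦ bᵢ aᵢ` (all other generators fixed) and `aᵢ ^ e ∈ M`
with `M` normal, then `(T ^ e) s · s⁻¹ ∈ M` for all `s ∈ S_g`. [folklore] -/
theorem stub_transvectionPowCongruent :
    ∀ (g e : ℕ) (i : Fin g) (M : Subgroup (SurfaceGroup g)), M.Normal →
      ∀ T : SurfaceGroup g ≃* SurfaceGroup g,
      (∀ x : surfaceGen g, T (PresentedGroup.of x) =
          if x = (i, true) then PresentedGroup.of (i, true) * PresentedGroup.of (i, false)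
          else PresentedGroup.of x) →
      (PresentedGroup.of (i, false) : SurfaceGroup g) ^ e ∈ M →
      ∀ s : SurfaceGroup g, (T ^ e) s * s⁻¹ ∈ M := by
  intro g e i M hM T hT he
  -- `T` fixes every generator other than `bᵢ`, in particular `aᵢ`
  have hT_ne : ∀ x : surfaceGen g, x ≠ (i, true) →
      T (PresentedGroup.of x) = PresentedGroup.of x := by
    intro x hx
    rw [hT x, if_neg hx]
  have hT_a : T (PresentedGroup.of (i, false)) = PresentedGroup.of (i, false) :=
    hT_ne _ (by simp)
  have hT_b : T (PresentedGroup.of (i, true)) =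
      PresentedGroup.of (i, true) * PresentedGroup.of (i, false) := by
    rw [hT _, if_pos rfl]
  -- powers of `T` on the generators
  have hpow_ne : ∀ (n : ℕ) (x : surfaceGen g), x ≠ (i, true) →
      (T ^ n) (PresentedGroup.of x) = PresentedGroup.of x := by
    intro n x hx
    induction n with
    | zero => simp
    | succ n ih => rw [pow_succ, MulAut.mul_apply, hT_ne x hx, ih]
  have hpow_b : ∀ n : ℕ, (T ^ n) (PresentedGroup.of (i, true)) =
      PresentedGroup.of (i, true) * (PresentedGroup.of (i, false) : SurfaceGroup g) ^ n := by
    intro n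
    induction n with
    | zero => simp
    | succ n ih =>
      rw [pow_succ, MulAut.mul_apply, hT_b, map_mul, ih, hpow_ne n (i, false) (by simp),
        pow_succ, mul_assoc]
  -- congruence on generators, then everywhere
  refine congruent_of_generators M (T ^ e).toMonoidHom ?_
  intro x
  change (T ^ e) (PresentedGroup.of x) * (PresentedGroup.of x)⁻¹ ∈ M
  by_cases hx : x = (i, true)
  · subst hx
    rw [hpow_b e]
    exact Subgroup.Normal.conj_mem hM _ he _
  · rw [hpow_ne e x hx, mul_inv_cancel]
    exact M.one_mem

end Summit.SmoothPoincare4.SmoothPoincare4.Theorems.ShadowsStandard.PowerTwistAbsorption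

end
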